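/-
Copyright (c) 2026 the pub-hodgecm-mathlib formalisation cell (harness21).  Prover seat hodgecm-mathlib-F0P2-p11 (g2) (L1; LEAD F0P6-plan (g14) «(o1) KIND 1», memo
`CENSUS-K1-DealTable` ADDENDUM 2 route (c)+(c″)+(c‴)+norm ASSEMBLED), Track B «K2-LIT» ∕ hLiu418 #184♮, ROAD Φ, G5-b: AN UPPER-TRIANGULAR LEVI TRANSLATE BEHIND THE
CORNER LINE IS A SCALAR AND A RESCALING OF THE LINE PARAMETER — `f(w₀ · n₂ t · Λ b · y) = σ(w₀Λbw₀) · f(w₀ · n₂(re N((b⁻¹)₁₁)·t) · y)`.  THEOREMS ONLY.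
-/
import Summits.HodgeConjecture.HodgeConjecture.Theorems.K2LiuReflStdTranslateReduction   -- ★ p862907
import Summits.HodgeConjecture.HodgeConjecture.Theorems.K2LiuLeviConjCornerCoordinate     -- ★ p862924
import Summits.HodgeConjecture.HodgeConjecture.Theorems.K2LiuAdeleRealPartBaseChange       -- ★ p862948
import HarnessLib

/-!
# Crux `HLiu418`, KIND 1, (K1b-W) translate reduction ON THE CORNER LINE: `f(w₀ · n₂ t · Λ b · y) = σ(w₀Λbw₀) · f(w₀ · n₂ t' · y)`, `t' = re N((b⁻¹)₁₁) · t`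

Cell `hodgecm-mathlib`, crux item hLiu418 = `stmt-HodgeConjecture-24832` (helper lane, count-neutral); squad K2 ∕ K2Liu, LEAD F0P6-plan (g14); prover F0P2-p11 (g2).
THEOREMS ONLY (no `def`, no `instance`, no notation, no named-fact hypothesis, no `sorry`).

For ANY corner line `n₂` of ★ p861153's shape (`n₂ t ∈ N_Δ(𝔸)`, `X(n₂ t) = single 1 1 ((t⊗1)δ)`), an upper-triangular `b ∈ GL₂(𝔸_L)` and a Siegel section `f ∈ I_Δ(s, χ)`:
**`apply_reflStd_cornerLine_levi_upper`** — `f (w₀ · n₂ t · Λ b · y) = σ_{χ,s}(w₀ Λb w₀) · f (w₀ · n₂ (re(N (b⁻¹)₁₁) · t) · y)` with `N x = x σ(x)` and `re` the real-part coordinate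
(★ p862907 `apply_reflStd_unip_levi_upper` at `u' := n₂ t'`; the corner coordinates agree by ★ p862924 `toBlocks₁₂_levi_conj_corner` and ★ p862948 `norm_mul_corner_coordinate`).
So in the K1-b♮ line term (★ p862785) the Levi translate only RESCALES the line parameter and multiplies by an explicit character — the Whittaker integral stays UNTRANSLATED.
HONEST LABEL.  Count-neutral helper; `HC_CM` is proved only modulo the 7 printed citations (2 remaining named inputs: hLiu418 = `stmt-HodgeConjecture-24832`,
h413 = `stmt-HodgeConjecture-24833`) until rung 0 closes.

## References
* [MoeglinWaldspurger1995] C. Mœglin, J.-L. Waldspurger, CUP (1995), II.1.7.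
* [KudlaRallis1994] S. Kudla, S. Rallis, Ann. of Math. 140 (1994), §2 (2.10)–(2.12).
-/

set_option autoImplicit false
set_option linter.dupNamespace false -- the mandated namespace repeats `HodgeConjecture.HodgeConjecture`

noncomputable section

open scoped Matrix
open NumberField IsDedekindDomain
open Literature.NumberTheory.Automorphic Literature.NumberTheory.Automorphic.UnitaryGroup Literature.NumberTheory.GaloisRepresentations
open Literature.NumberTheory.GelbartRogawski1991 Literature.NumberTheory.GelbartRogawski1991.GRConstruction
open Literature.NumberTheory.GelbartRogawski1991.AdaptedBlocks
open Literature.NumberTheory.K2Lit.SiegelDoubled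
open UnitaryDualPair

namespace Summit.HodgeConjecture.HodgeConjecture.Cruxes.HLiu418.K2LiuCornerLineLeviTranslate

open K2LiuSiegelUnipotentFourierDefs K2LiuReflStdTranslateReduction K2LiuLeviConjCornerCoordinate K2LiuAdeleRealPartBaseChange

variable (L : Type) [Field L] [NumberField L] [IsCMField L]
variable {N M : ℕ} (e : Fin N × Fin M ≃ Fin 2)
  (dV : Fin N → L) (hdV : ∀ i, IsCMField.complexConj L (dV i) = dV i)
  (dW : Fin M → L) (hdW : ∀ i, IsCMField.complexConj L (dW i) = dW i)

variable {g₀ : UnitaryGroup.rationalPair (Fp L) L (IsCMField.complexConj L) N M (Matrix.diagonal dV) (Matrix.diagonal dW)}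
  (hg₀ : ((g₀ : GL (Fin N × Fin M) L) : Matrix (Fin N × Fin M) (Fin N × Fin M) L) = Matrix.diagonal (fun k => 1 - 2 * (![0, 1] : Fin 2 → L) (e k)))
  (Λ : GL (Fin 2) (AdeleRing (𝓞 L) L) →* HA L e dV hdV dW hdW)
  (hΛ : ∀ g : GL (Fin 2) (AdeleRing (𝓞 L) L), blk L e dV hdV dW hdW (Λ g) =
    cayR (AdeleRing (𝓞 L) L) (Fin 2) * Matrix.fromBlocks (g : Matrix (Fin 2) (Fin 2) (AdeleRing (𝓞 L) L)) 0 0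
      (((gramR L e dV hdV dW hdW).map ((algebraMap L (AdeleRing (𝓞 L) L)).comp (algebraMap (Fp L) L)))⁻¹ *
        (((g⁻¹ : GL (Fin 2) (AdeleRing (𝓞 L) L)) : Matrix (Fin 2) (Fin 2) (AdeleRing (𝓞 L) L)).map
          (conjAdele (Fp L) L (IsCMField.complexConj L)))ᵀ *
        (gramR L e dV hdV dW hdW).map ((algebraMap L (AdeleRing (𝓞 L) L)).comp (algebraMap (Fp L) L))) *
      cayRinv (AdeleRing (𝓞 L) L) (Fin 2))

include hg₀ hΛ in
/-- **THE TRANSLATE REDUCTION ON THE CORNER LINE**: `f (w₀ · n₂ t · Λ b · y) = σ_{χ,s}(w₀ Λ b w₀) · f (w₀ · n₂ (re(N (b⁻¹)₁₁) · t) · y)` for a corner line `n₂`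
(`n₂ t ∈ N_Δ(𝔸)`, `X(n₂ t) = single 1 1 ((t⊗1)δ)`), `b` upper triangular, `f ∈ I_Δ(s, χ)`; `N x = x·σ(x)`, `re` = the real-part coordinate of `Ψ_𝔸`.
[cite: MoeglinWaldspurger1995, II.1.7] [cite: KudlaRallis1994, §2 (2.10)–(2.12)] -/
theorem apply_reflStd_cornerLine_levi_upper (hdV0 : ∀ i, dV i ≠ 0) (hdW0 : ∀ i, dW i ≠ 0)
    {χ : HeckeCharacter L} {s : ℂ} {f : HA L e dV hdV dW hdW → ℂ} (hf : IsSiegelDeltaSection L e dV hdV dW hdW χ s f)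
    (n₂ : AdeleRing (𝓞 (Fp L)) (Fp L) → HA L e dV hdV dW hdW) (hn₂mem : ∀ t, n₂ t ∈ unipDelta L e dV hdV dW hdW)
    (hn₂X : ∀ t, (blk L e dV hdV dW hdW (n₂ t)).toBlocks₁₂ =
      Matrix.single (1 : Fin 2) (1 : Fin 2) (AdeleRing.baseChange (Fp L) L t * algebraMap L (AdeleRing (𝓞 L) L) (imagUnit L)))
    (b : GL (Fin 2) (AdeleRing (𝓞 L) L)) (hb : (b : Matrix (Fin 2) (Fin 2) (AdeleRing (𝓞 L) L)) 1 0 = 0) (t : AdeleRing (𝓞 (Fp L)) (Fp L)) (y : HA L e dV hdV dW hdW) :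
    f (iotaGG L e dV hdV dW hdW (1, UnitaryGroup.rationalPairToAdelic (Fp L) L (IsCMField.complexConj L) N M (Matrix.diagonal dV) (Matrix.diagonal dW) g₀) * n₂ t * Λ b * y) =
      siegelDeltaCharacter L e dV hdV dW hdW χ s
          (iotaGG L e dV hdV dW hdW (1, UnitaryGroup.rationalPairToAdelic (Fp L) L (IsCMField.complexConj L) N M (Matrix.diagonal dV) (Matrix.diagonal dW) g₀) * Λ b *
            iotaGG L e dV hdV dW hdW (1, UnitaryGroup.rationalPairToAdelic (Fp L) L (IsCMField.complexConj L) N M (Matrix.diagonal dV) (Matrix.diagonal dW) g₀)) *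
        f (iotaGG L e dV hdV dW hdW (1, UnitaryGroup.rationalPairToAdelic (Fp L) L (IsCMField.complexConj L) N M (Matrix.diagonal dV) (Matrix.diagonal dW) g₀) *
          n₂ (((quadraticAdeleEquiv (Fp L) L (IsCMField.complexConj L) (complexConj_imagUnit L) (imagUnit_ne_zero L)).symm
              ((((b⁻¹ : GL (Fin 2) (AdeleRing (𝓞 L) L)) : Matrix (Fin 2) (Fin 2) (AdeleRing (𝓞 L) L)) 1 1) *
                conjAdele (Fp L) L (IsCMField.complexConj L) ((((b⁻¹ : GL (Fin 2) (AdeleRing (𝓞 L) L)) : Matrix (Fin 2) (Fin 2) (AdeleRing (𝓞 L) L)) 1 1)))).1 * t) * y) := by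
  refine apply_reflStd_unip_levi_upper L e dV hdV dW hdW hg₀ Λ hΛ hf (hn₂mem t) b hb (hn₂mem _) ?_ y
  rw [hn₂X, Matrix.single_apply_same, toBlocks₁₂_levi_conj_corner L e dV hdV dW hdW Λ hΛ hdV0 hdW0 b (hn₂mem t) (hn₂X t), norm_mul_corner_coordinate]

end Summit.HodgeConjecture.HodgeConjecture.Cruxes.HLiu418.K2LiuCornerLineLeviTranslate

end
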